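import Summits.ValiantsHypothesis.ValiantsHypothesis.Theorems.KPlusLogSqLawTropicalBMatchingExchange

/-!
# Route «KPlusLogSqLaw», crux `TropicalB` (stmt-ValiantsHypothesis-19771) — CONCAVITY AND THE INTERLACING LAW FOR PARAMETRIC
# `k`-MATCHING OPTIMA UNDER VERTEX DELETION (witness form)

HONEST FRAMING.  Helper toward the registered stubs `stub_tropThin` / `stub_tropFat` of `Cruxes/TropicalB/Lines/birth.lean`
(crux `Summit.ValiantsHypothesis.ValiantsHypothesis.Theses.KPlusLogSqLaw.TropicalB`, item stmt-ValiantsHypothesis-19771, route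
KPlusLogSqLaw; cell `pub-symmetroid`, seat val-sym-trop-p1 g8, 2026-08-27; `--supports … --as helper`).  A COMBINATORIAL ENGINE;
nothing here bounds `TropicalB` or bears on `WeakLifting`, DoorA26 / DoorA34, `MatrixDescartes` (stmt-ValiantsHypothesis-18050) or
VP ≠ VNP.

THE POINT.  For an allowed edge set `G ⊆ α × β` with weights `w`, let `ω_k(G)` be the maximum weight of a `k`-matching inside `G`.
The parametric problem `θ ↦ max_k (θ·k + ω_k(G))` — one LEVEL of the lexicographic tower of a separated dominance design (seat memo
SEPARATED-LEVELS-g8.md) — has its breakpoints at the thresholds `t_k(G) = ω_{k−1}(G) − ω_k(G)`.  From the exchange lemma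
(…TropicalBMatchingExchange) we derive, in WITNESS form (two given matchings are traded for two new ones inside the right edge sets,
with the right sizes and the same total weight for every `w` — no maximum is taken, which is the form the level analysis consumes):

* `wt_add_eq`, `card_add_eq`, `row_exclusive` / `col_exclusive` (+ primed) — bookkeeping of an exchange: weights and sizes add up,
  and a vertex unused by one of `M₁, M₂` is used by at most one of `N₁, N₂`;
* `concave` — CONCAVITY `2·ω_k ≥ ω_{k−1} + ω_{k+1}` (thresholds increase with `k`);
* `interlace_row₁`, `interlace_row₂` (`interlace_col₁`, `interlace_col₂`) — the INTERLACING LAW under deletion of a row (column) `v`: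
  `ω_k(G) + ω_{k−1}(G−v) ≥ ω_{k−1}(G) + ω_k(G−v)` and `ω_k(G−v) + ω_k(G) ≥ ω_{k−1}(G−v) + ω_{k+1}(G)`, i.e.
  `t_k(G) ≤ t_k(G − v) ≤ t_{k+1}(G)`: deleting one vertex moves every threshold to the right, but never past the next one — so the
  parametric optimum's cardinality drops by AT MOST ONE per deleted vertex and never increases.  In the separated dense-bottom sector
  this is why a carry of a higher digit cannot reset a lower digit (memo §2), against SHIFT-THREE's full resets by scale coupling.

[folklore: M♮-concavity of the assignment valuation — Murota, Discrete Convex Analysis (2003) §9; Shapley 1962]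
-/

set_option linter.dupNamespace false
set_option autoImplicit false

namespace Summit.ValiantsHypothesis.ValiantsHypothesis.Theorems.KPlusLogSqLaw

namespace MatchingExchange

open Finset
open scoped BigOperators
open Literature.Computability.MetaComplexity.PBij

variable {α β : Type*} [DecidableEq α] [DecidableEq β]

/-! ### Consequences of an exchange: weights, sizes, supports -/

/-- Weights add up across an exchange (for every weight). [folklore] -/
theorem wt_add_eq {M₁ M₂ N₁ N₂ : Finset (α × β)} (hU : N₁ ∪ N₂ = M₁ ∪ M₂) (hI : N₁ ∩ N₂ = M₁ ∩ M₂) (w : α × β → ℤ) :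
    ∑ e ∈ N₁, w e + ∑ e ∈ N₂, w e = ∑ e ∈ M₁, w e + ∑ e ∈ M₂, w e := by
  rw [← Finset.sum_union_inter, hU, hI, Finset.sum_union_inter]

/-- Sizes add up across an exchange, so `|N₂| + 1 = |M₂|`. [folklore] -/
theorem card_add_eq {M₁ M₂ N₁ N₂ : Finset (α × β)} (hU : N₁ ∪ N₂ = M₁ ∪ M₂) (hI : N₁ ∩ N₂ = M₁ ∩ M₂)
    (hc : N₁.card = M₁.card + 1) : N₂.card + 1 = M₂.card := by
  have h1 := Finset.card_union_add_card_inter N₁ N₂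
  have h2 := Finset.card_union_add_card_inter M₁ M₂
  rw [hU, hI] at h1
  omega

/-- The new matchings use only old edges. [folklore] -/
theorem subset_union_left {M₁ M₂ N₁ N₂ : Finset (α × β)} (hU : N₁ ∪ N₂ = M₁ ∪ M₂) : N₁ ⊆ M₁ ∪ M₂ :=
  hU ▸ Finset.subset_union_left

/-- The new matchings use only old edges. [folklore] -/
theorem subset_union_right {M₁ M₂ N₁ N₂ : Finset (α × β)} (hU : N₁ ∪ N₂ = M₁ ∪ M₂) : N₂ ⊆ M₁ ∪ M₂ :=
  hU ▸ Finset.subset_union_right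

/-- **Row exclusivity.**  A row unused by `M₂` is used by at most one of `N₁`, `N₂`. [folklore] -/
theorem row_exclusive {M₁ M₂ N₁ N₂ : Finset (α × β)} (hU : N₁ ∪ N₂ = M₁ ∪ M₂) (hI : N₁ ∩ N₂ = M₁ ∩ M₂)
    (h₁ : IsPMatching M₁) {v : α}
    (hv : v ∉ dom M₂) (hv₁ : v ∈ dom N₁) : v ∉ dom N₂ := by
  intro hv₂
  obtain ⟨x, hx⟩ := mem_dom.1 hv₁
  obtain ⟨y, hy⟩ := mem_dom.1 hv₂
  have hxM : (v, x) ∈ M₁ := by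
    rcases Finset.mem_union.1 (subset_union_left hU hx) with k | k
    · exact k
    · exact absurd (mem_dom.2 ⟨x, k⟩) hv
  have hyM : (v, y) ∈ M₁ := by
    rcases Finset.mem_union.1 (subset_union_right hU hy) with k | k
    · exact k
    · exact absurd (mem_dom.2 ⟨y, k⟩) hv
  have hxy : x = y := h₁.eq_of_fst_eq hxM hyM
  subst hxy
  have : (v, x) ∈ M₁ ∩ M₂ := hI ▸ Finset.mem_inter.2 ⟨hx, hy⟩
  exact hv (mem_dom.2 ⟨x, (Finset.mem_inter.1 this).2⟩)

/-- Row exclusivity, the other side: a row unused by `M₁` is used by at most one of `N₁`, `N₂`. [folklore] -/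
theorem row_exclusive' {M₁ M₂ N₁ N₂ : Finset (α × β)} (hU : N₁ ∪ N₂ = M₁ ∪ M₂) (hI : N₁ ∩ N₂ = M₁ ∩ M₂)
    (h₂ : IsPMatching M₂) {v : α}
    (hv : v ∉ dom M₁) (hv₁ : v ∈ dom N₁) : v ∉ dom N₂ := by
  intro hv₂
  obtain ⟨x, hx⟩ := mem_dom.1 hv₁
  obtain ⟨y, hy⟩ := mem_dom.1 hv₂
  have hxM : (v, x) ∈ M₂ := by
    rcases Finset.mem_union.1 (subset_union_left hU hx) with k | k
    · exact absurd (mem_dom.2 ⟨x, k⟩) hv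
    · exact k
  have hyM : (v, y) ∈ M₂ := by
    rcases Finset.mem_union.1 (subset_union_right hU hy) with k | k
    · exact absurd (mem_dom.2 ⟨y, k⟩) hv
    · exact k
  have hxy : x = y := h₂.eq_of_fst_eq hxM hyM
  subst hxy
  have : (v, x) ∈ M₁ ∩ M₂ := hI ▸ Finset.mem_inter.2 ⟨hx, hy⟩
  exact hv (mem_dom.2 ⟨x, (Finset.mem_inter.1 this).1⟩)

/-- **Column exclusivity.**  A column unused by `M₂` is used by at most one of `N₁`, `N₂`. [folklore] -/
theorem col_exclusive {M₁ M₂ N₁ N₂ : Finset (α × β)} (hU : N₁ ∪ N₂ = M₁ ∪ M₂) (hI : N₁ ∩ N₂ = M₁ ∩ M₂)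
    (h₁ : IsPMatching M₁) {v : β}
    (hv : v ∉ rng M₂) (hv₁ : v ∈ rng N₁) : v ∉ rng N₂ := by
  intro hv₂
  obtain ⟨x, hx⟩ := mem_rng.1 hv₁
  obtain ⟨y, hy⟩ := mem_rng.1 hv₂
  have hxM : (x, v) ∈ M₁ := by
    rcases Finset.mem_union.1 (subset_union_left hU hx) with k | k
    · exact k
    · exact absurd (mem_rng.2 ⟨x, k⟩) hv
  have hyM : (y, v) ∈ M₁ := by
    rcases Finset.mem_union.1 (subset_union_right hU hy) with k | k
    · exact k
    · exact absurd (mem_rng.2 ⟨y, k⟩) hv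
  have hxy : x = y := h₁.eq_of_snd_eq hxM hyM
  subst hxy
  have : (x, v) ∈ M₁ ∩ M₂ := hI ▸ Finset.mem_inter.2 ⟨hx, hy⟩
  exact hv (mem_rng.2 ⟨x, (Finset.mem_inter.1 this).2⟩)

/-- Column exclusivity, the other side. [folklore] -/
theorem col_exclusive' {M₁ M₂ N₁ N₂ : Finset (α × β)} (hU : N₁ ∪ N₂ = M₁ ∪ M₂) (hI : N₁ ∩ N₂ = M₁ ∩ M₂)
    (h₂ : IsPMatching M₂) {v : β}
    (hv : v ∉ rng M₁) (hv₁ : v ∈ rng N₁) : v ∉ rng N₂ := by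
  intro hv₂
  obtain ⟨x, hx⟩ := mem_rng.1 hv₁
  obtain ⟨y, hy⟩ := mem_rng.1 hv₂
  have hxM : (x, v) ∈ M₂ := by
    rcases Finset.mem_union.1 (subset_union_left hU hx) with k | k
    · exact absurd (mem_rng.2 ⟨x, k⟩) hv
    · exact k
  have hyM : (y, v) ∈ M₂ := by
    rcases Finset.mem_union.1 (subset_union_right hU hy) with k | k
    · exact absurd (mem_rng.2 ⟨y, k⟩) hv
    · exact k
  have hxy : x = y := h₂.eq_of_snd_eq hxM hyM
  subst hxy
  have : (x, v) ∈ M₁ ∩ M₂ := hI ▸ Finset.mem_inter.2 ⟨hx, hy⟩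
  exact hv (mem_rng.2 ⟨x, (Finset.mem_inter.1 this).1⟩)

/-! ### Concavity and interlacing, witness form

`G : Finset (α × β)` is the set of allowed (present) edges; deleting the row `v` is `G.filter (·.1 ≠ v)`, deleting the column
`v` is `G.filter (·.2 ≠ v)`. -/

omit [DecidableEq β] in
/-- a set of edges avoiding row `v` inside `G` lies inside `G` with row `v` deleted. -/
theorem subset_filter_row {N G : Finset (α × β)} {v : α} (hN : N ⊆ G) (hv : v ∉ dom N) :
    N ⊆ G.filter (fun e => e.1 ≠ v) := by
  intro e he
  refine Finset.mem_filter.2 ⟨hN he, fun h => hv (mem_dom.2 ⟨e.2, ?_⟩)⟩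
  rw [← h]; exact he

omit [DecidableEq α] in
/-- a set of edges avoiding column `v` inside `G` lies inside `G` with column `v` deleted. -/
theorem subset_filter_col {N G : Finset (α × β)} {v : β} (hN : N ⊆ G) (hv : v ∉ rng N) :
    N ⊆ G.filter (fun e => e.2 ≠ v) := by
  intro e he
  refine Finset.mem_filter.2 ⟨hN he, fun h => hv (mem_rng.2 ⟨e.1, ?_⟩)⟩
  rw [← h]; exact he

/-- **CONCAVITY of `k ↦ ω_k`** (witness form): a `(k−1)`-matching and a `(k+1)`-matching inside `G` can be traded for two
`k`-matchings inside `G` with the same total weight; hence `2·ω_k ≥ ω_{k−1} + ω_{k+1}`. [folklore: Murota DCA §9] -/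
theorem concave {G M₁ M₂ : Finset (α × β)} (h₁ : IsPMatching M₁) (h₂ : IsPMatching M₂) (hG₁ : M₁ ⊆ G) (hG₂ : M₂ ⊆ G)
    {k : ℕ} (hc₁ : M₁.card + 1 = k) (hc₂ : M₂.card = k + 1) :
    ∃ N₁ N₂ : Finset (α × β), IsPMatching N₁ ∧ IsPMatching N₂ ∧ N₁ ⊆ G ∧ N₂ ⊆ G ∧ N₁.card = k ∧ N₂.card = k ∧
      ∀ w : α × β → ℤ, ∑ e ∈ N₁, w e + ∑ e ∈ N₂, w e = ∑ e ∈ M₁, w e + ∑ e ∈ M₂, w e := by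
  obtain ⟨N₁, N₂, hN₁, hN₂, hU, hI, hcE, hdom, hrng⟩ := exchange h₁ h₂ (by omega)
  have hUG : M₁ ∪ M₂ ⊆ G := Finset.union_subset hG₁ hG₂
  have hc := card_add_eq hU hI hcE
  exact ⟨N₁, N₂, hN₁, hN₂, (subset_union_left hU).trans hUG, (subset_union_right hU).trans hUG, by rw [hcE]; omega,
    by omega, wt_add_eq hU hI⟩

/-- **INTERLACING under ROW deletion, first exchange** (witness form of `ω_k(G) + ω_{k−1}(G−v) ≥ ω_{k−1}(G) + ω_k(G−v)`):
a `(k−1)`-matching inside `G` and a `k`-matching inside `G − v` can be traded for a `k`-matching inside `G` and a `(k−1)`-matching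
inside `G − v`, same total weight. [folklore: M♮-concavity of the assignment valuation] -/
theorem interlace_row₁ {G M₁ M₂ : Finset (α × β)} {v : α} (h₁ : IsPMatching M₁) (h₂ : IsPMatching M₂) (hG₁ : M₁ ⊆ G)
    (hG₂ : M₂ ⊆ G.filter (fun e => e.1 ≠ v)) (hc : M₁.card + 1 = M₂.card) :
    ∃ N₁ N₂ : Finset (α × β), IsPMatching N₁ ∧ IsPMatching N₂ ∧ N₁ ⊆ G ∧ N₂ ⊆ G.filter (fun e => e.1 ≠ v) ∧
      N₁.card = M₂.card ∧ N₂.card = M₁.card ∧ ∀ w : α × β → ℤ, ∑ e ∈ N₁, w e + ∑ e ∈ N₂, w e = ∑ e ∈ M₁, w e + ∑ e ∈ M₂, w e := by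
  obtain ⟨N₁, N₂, hN₁, hN₂, hU, hI, hcE, hdom, hrng⟩ := exchange h₁ h₂ (by omega)
  have hG₂' : M₂ ⊆ G := hG₂.trans (Finset.filter_subset _ _)
  have hUG : M₁ ∪ M₂ ⊆ G := Finset.union_subset hG₁ hG₂'
  have hvM₂ : v ∉ dom M₂ := by
    intro hv; obtain ⟨y, hy⟩ := mem_dom.1 hv
    exact (Finset.mem_filter.1 (hG₂ hy)).2 rfl
  have hcN := card_add_eq hU hI hcE
  refine ⟨N₁, N₂, hN₁, hN₂, (subset_union_left hU).trans hUG, ?_, by rw [hcE]; omega, by omega, wt_add_eq hU hI⟩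
  refine subset_filter_row ((subset_union_right hU).trans hUG) fun hvN₂ => ?_
  -- if `v` were a row of `N₂`: it is a row of `M₁ ∪ M₂`, hence of `M₁`, hence of `N₁` — contradicting exclusivity
  obtain ⟨y, hy⟩ := mem_dom.1 hvN₂
  have hvM₁ : v ∈ dom M₁ := by
    rcases Finset.mem_union.1 (subset_union_right hU hy) with k | k
    · exact mem_dom.2 ⟨y, k⟩
    · exact absurd (mem_dom.2 ⟨y, k⟩) hvM₂
  exact row_exclusive hU hI h₁ hvM₂ (hdom hvM₁) hvN₂

/-- **INTERLACING under ROW deletion, second exchange** (witness form of `ω_k(G−v) + ω_k(G) ≥ ω_{k−1}(G−v) + ω_{k+1}(G)`):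
a `(k−1)`-matching inside `G − v` and a `(k+1)`-matching inside `G` can be traded for two `k`-matchings, one inside `G − v` and one
inside `G`, same total weight. [folklore: M♮-concavity of the assignment valuation] -/
theorem interlace_row₂ {G M₁ M₂ : Finset (α × β)} {v : α} (h₁ : IsPMatching M₁) (h₂ : IsPMatching M₂)
    (hG₁ : M₁ ⊆ G.filter (fun e => e.1 ≠ v)) (hG₂ : M₂ ⊆ G) {k : ℕ} (hc₁ : M₁.card + 1 = k) (hc₂ : M₂.card = k + 1) :
    ∃ N₁ N₂ : Finset (α × β), IsPMatching N₁ ∧ IsPMatching N₂ ∧ N₁ ⊆ G.filter (fun e => e.1 ≠ v) ∧ N₂ ⊆ G ∧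
      N₁.card = k ∧ N₂.card = k ∧ ∀ w : α × β → ℤ, ∑ e ∈ N₁, w e + ∑ e ∈ N₂, w e = ∑ e ∈ M₁, w e + ∑ e ∈ M₂, w e := by
  obtain ⟨N₁, N₂, hN₁, hN₂, hU, hI, hcE, hdom, hrng⟩ := exchange h₁ h₂ (by omega)
  have hG₁' : M₁ ⊆ G := hG₁.trans (Finset.filter_subset _ _)
  have hUG : M₁ ∪ M₂ ⊆ G := Finset.union_subset hG₁' hG₂
  have hvM₁ : v ∉ dom M₁ := by
    intro hv; obtain ⟨y, hy⟩ := mem_dom.1 hv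
    exact (Finset.mem_filter.1 (hG₁ hy)).2 rfl
  have hcN := card_add_eq hU hI hcE
  have hc1 : N₁.card = k := by rw [hcE]; omega
  have hc2 : N₂.card = k := by omega
  by_cases hvN₁ : v ∈ dom N₁
  · -- `v` moved into `N₁`; then `N₂` avoids `v`: report `(N₂, N₁)`
    have hvN₂ : v ∉ dom N₂ := row_exclusive' hU hI h₂ hvM₁ hvN₁
    refine ⟨N₂, N₁, hN₂, hN₁, subset_filter_row ((subset_union_right hU).trans hUG) hvN₂,
      (subset_union_left hU).trans hUG, hc2, hc1, fun w => ?_⟩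
    rw [add_comm]; exact wt_add_eq hU hI w
  · exact ⟨N₁, N₂, hN₁, hN₂, subset_filter_row ((subset_union_left hU).trans hUG) hvN₁,
      (subset_union_right hU).trans hUG, hc1, hc2, wt_add_eq hU hI⟩

/-- **INTERLACING under COLUMN deletion, first exchange.** [folklore] -/
theorem interlace_col₁ {G M₁ M₂ : Finset (α × β)} {v : β} (h₁ : IsPMatching M₁) (h₂ : IsPMatching M₂) (hG₁ : M₁ ⊆ G)
    (hG₂ : M₂ ⊆ G.filter (fun e => e.2 ≠ v)) (hc : M₁.card + 1 = M₂.card) :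
    ∃ N₁ N₂ : Finset (α × β), IsPMatching N₁ ∧ IsPMatching N₂ ∧ N₁ ⊆ G ∧ N₂ ⊆ G.filter (fun e => e.2 ≠ v) ∧
      N₁.card = M₂.card ∧ N₂.card = M₁.card ∧ ∀ w : α × β → ℤ, ∑ e ∈ N₁, w e + ∑ e ∈ N₂, w e = ∑ e ∈ M₁, w e + ∑ e ∈ M₂, w e := by
  obtain ⟨N₁, N₂, hN₁, hN₂, hU, hI, hcE, hdom, hrng⟩ := exchange h₁ h₂ (by omega)
  have hG₂' : M₂ ⊆ G := hG₂.trans (Finset.filter_subset _ _)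
  have hUG : M₁ ∪ M₂ ⊆ G := Finset.union_subset hG₁ hG₂'
  have hvM₂ : v ∉ rng M₂ := by
    intro hv; obtain ⟨y, hy⟩ := mem_rng.1 hv
    exact (Finset.mem_filter.1 (hG₂ hy)).2 rfl
  have hcN := card_add_eq hU hI hcE
  refine ⟨N₁, N₂, hN₁, hN₂, (subset_union_left hU).trans hUG, ?_, by rw [hcE]; omega, by omega, wt_add_eq hU hI⟩
  refine subset_filter_col ((subset_union_right hU).trans hUG) fun hvN₂ => ?_
  obtain ⟨y, hy⟩ := mem_rng.1 hvN₂
  have hvM₁ : v ∈ rng M₁ := by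
    rcases Finset.mem_union.1 (subset_union_right hU hy) with k | k
    · exact mem_rng.2 ⟨y, k⟩
    · exact absurd (mem_rng.2 ⟨y, k⟩) hvM₂
  exact col_exclusive hU hI h₁ hvM₂ (hrng hvM₁) hvN₂

/-- **INTERLACING under COLUMN deletion, second exchange.** [folklore] -/
theorem interlace_col₂ {G M₁ M₂ : Finset (α × β)} {v : β} (h₁ : IsPMatching M₁) (h₂ : IsPMatching M₂)
    (hG₁ : M₁ ⊆ G.filter (fun e => e.2 ≠ v)) (hG₂ : M₂ ⊆ G) {k : ℕ} (hc₁ : M₁.card + 1 = k) (hc₂ : M₂.card = k + 1) :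
    ∃ N₁ N₂ : Finset (α × β), IsPMatching N₁ ∧ IsPMatching N₂ ∧ N₁ ⊆ G.filter (fun e => e.2 ≠ v) ∧ N₂ ⊆ G ∧
      N₁.card = k ∧ N₂.card = k ∧ ∀ w : α × β → ℤ, ∑ e ∈ N₁, w e + ∑ e ∈ N₂, w e = ∑ e ∈ M₁, w e + ∑ e ∈ M₂, w e := by
  obtain ⟨N₁, N₂, hN₁, hN₂, hU, hI, hcE, hdom, hrng⟩ := exchange h₁ h₂ (by omega)
  have hG₁' : M₁ ⊆ G := hG₁.trans (Finset.filter_subset _ _)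
  have hUG : M₁ ∪ M₂ ⊆ G := Finset.union_subset hG₁' hG₂
  have hvM₁ : v ∉ rng M₁ := by
    intro hv; obtain ⟨y, hy⟩ := mem_rng.1 hv
    exact (Finset.mem_filter.1 (hG₁ hy)).2 rfl
  have hcN := card_add_eq hU hI hcE
  have hc1 : N₁.card = k := by rw [hcE]; omega
  have hc2 : N₂.card = k := by omega
  by_cases hvN₁ : v ∈ rng N₁
  · have hvN₂ : v ∉ rng N₂ := col_exclusive' hU hI h₂ hvM₁ hvN₁
    refine ⟨N₂, N₁, hN₂, hN₁, subset_filter_col ((subset_union_right hU).trans hUG) hvN₂,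
      (subset_union_left hU).trans hUG, hc2, hc1, fun w => ?_⟩
    rw [add_comm]; exact wt_add_eq hU hI w
  · exact ⟨N₁, N₂, hN₁, hN₂, subset_filter_col ((subset_union_left hU).trans hUG) hvN₁,
      (subset_union_right hU).trans hUG, hc1, hc2, wt_add_eq hU hI⟩

end MatchingExchange

end Summit.ValiantsHypothesis.ValiantsHypothesis.Theorems.KPlusLogSqLaw
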